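import Summits.BirchSwinnertonDyer.BirchSwinnertonDyer.Theorems.UniversalToricDescentThinCombWeakVisibility
import HarnessLib

/-!
# Thin-comb rigidity (crux idea `thin-comb-reflection` on the WALL `AdditiveSplitIMCInclusionAtThree`, item
# stmt-BirchSwinnertonDyer-20395) — Part VII: RIGIDITY FOR WEAK REFLECTIONS (helper,
# `--supports stmt-BirchSwinnertonDyer-20395`; cell `pub/bsd-wall`, lead `cruxlead-20395` g2)

MAIN RESULTS (every DVR `𝒪` with maximal ideal `(p)`): `dvd_pow_mul_of_weakReflection` / `dvd_of_weakReflection` —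
if `ρ` is a ring automorphism of `𝒪⟦T₂⟧⟦T₁⟧` FIXING CONSTANTS with `ρ T₂ ∉ (p, T₂)` (it does not stabilise the comb's
bad ideal), and `G, F` are `ρ`-symmetric up to units with `G ∣ p^{t_m}·F (mod E_m(T₂))` on comb levels of unbounded
order, then `G ∣ p^a·F` (resp. `G ∣ F` for an integral comb). `reflection_T₂_not_mem`: an `IsReflection` is weak, so
Part IV is the special case `ρ T₂ ∼ T₁`. Trichotomy for a prime `P ∣ G₀` (`G = pⁿG₀`, `p ∤ G₀`): `P ∉ (p, T₂)`
visible on every level (Part II); `P ∈ (p, T₂) ∩ (p, ρT₂)` visible on deep levels (Part VI); `P ∈ (p, T₂) ∖ (p, ρT₂)`: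
`ρ⁻¹P ∉ (p, T₂)` divides `ρ⁻¹G₀ ∼ G₀`, so `(ρ⁻¹P)^k ∣ F` (Part III) and `P^k ∣ ρF ∼ F`.

USE (line `thin_comb`): take ANY `ℤ_p`-basis `(γ₁, γ₂)` of `Gal(K̃_∞/K)` with `γ₂` spanning the saturated `𝔭′`-inertia
line (comb vertical) and `ρ := c∘ι`; then `ρ(T₂) = (cγ₂c)⁻¹ − 1 ∉ (p, T₂)` because `cγ₂c` spans the `𝔭`-inertia line
`≠` the `𝔭′`-line — no generator-PAIR condition on the two split-prime lines is needed.

Theorems only; nothing about elliptic curves; BSD is not proved by any of this.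
References: Washington §7.1–7.2, §13.4 [cite: Washington1997, §7.1–§7.2 and §13.4]; Matsumura Thm. 20.3
[cite: Matsumura1987, Thm. 20.3].
-/

set_option linter.dupNamespace false

noncomputable section

namespace Summit.BirchSwinnertonDyer.BirchSwinnertonDyer.Theorems.UniversalToricDescentThinComb

/-! ## §9 Rigidity for weak reflections -/

section WeakMain

variable (𝒪 : Type*) [CommRing 𝒪] [IsDomain 𝒪] [IsDiscreteValuationRing 𝒪] (p : ℕ) [hp : Fact p.Prime]

/-- **The `p`-free part divides `F` — weak-reflection form.** As `pfree_dvd_of_levels`, but `ρ` is only required to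
fix constants and NOT to stabilise the ideal `(p, T₂)` (`ρ T₂ ∉ (p, T₂)`). Trichotomy for a prime `P ∣ G₀`:
`P ∉ (p, T₂)` visible everywhere; `P ∈ (p, T₂) ∩ (p, ρT₂)` visible on deep levels (§8); `P ∈ (p, T₂) ∖ (p, ρT₂)`:
`ρ⁻¹P ∉ (p, T₂)` divides `ρ⁻¹G₀ ∼ G₀`, so `(ρ⁻¹P)^k ∣ F` and `P^k ∣ ρF ∼ F`.
[cite: Washington1997, §7.1–§7.2 and §13.4; Matsumura1987, Thm. 20.3] -/
theorem pfree_dvd_of_levels_weak (hmax : IsLocalRing.maximalIdeal 𝒪 = Ideal.span {(p : 𝒪)})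
    {ρ : PowerSeries (PowerSeries 𝒪) ≃+* PowerSeries (PowerSeries 𝒪)} (hρc : ∀ c : 𝒪, ρ (const 𝒪 c) = const 𝒪 c)
    (hρT : ρ (T₂ 𝒪) ∉ Ideal.span {const 𝒪 (p : 𝒪), T₂ 𝒪})
    {G₀ F : PowerSeries (PowerSeries 𝒪)} (hG₀0 : G₀ ≠ 0) (hG₀p : ¬ const 𝒪 (p : 𝒪) ∣ G₀)
    (hρG₀ : Associated (ρ G₀) G₀) (hF : Associated (ρ F) F)
    (hlev : ∀ n : ℕ, ∃ m : ℕ, n ≤ m ∧ ∃ t : ℕ, const 𝒪 ((p : 𝒪) ^ t) * F ∈ Ideal.span {G₀, combElt 𝒪 p m}) :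
    G₀ ∣ F := by
  classical
  obtain ⟨hp0, hpu, hprime, hpprime⟩ := p_ne_zero_of_maximalIdeal_eq 𝒪 p hmax
  haveI := Literature.NumberTheory.IwasawaTheory.uniqueFactorizationMonoid_powerSeries_powerSeries 𝒪
  have hcp : Prime (const 𝒪 (p : 𝒪)) :=
    Literature.NumberTheory.EllipticCurves.prime_C_of_prime (Literature.NumberTheory.EllipticCurves.prime_C_of_prime hpprime)
  have hlevD : ∀ D, D ∣ G₀ → ∀ n : ℕ, ∃ m : ℕ, n ≤ m ∧
      ∃ t : ℕ, const 𝒪 ((p : 𝒪) ^ t) * F ∈ Ideal.span {D, combElt 𝒪 p m} := by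
    rintro D ⟨c, rfl⟩ n
    obtain ⟨m, hnm, t, hmem⟩ := hlev n
    obtain ⟨a, b, hab⟩ := Ideal.mem_span_pair.mp hmem
    exact ⟨m, hnm, t, Ideal.mem_span_pair.mpr ⟨a * c, b, by rw [← hab]; ring⟩⟩
  have hρsymm_const : ∀ c : 𝒪, ρ.symm (const 𝒪 c) = const 𝒪 c := fun c => by
    rw [RingEquiv.symm_apply_eq, hρc]
  -- `ρ⁻¹ G₀ ∼ G₀` and `ρ F ∣ F`
  have hρsG₀ : Associated (ρ.symm G₀) G₀ := by
    obtain ⟨u, hu⟩ := hρG₀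
    have h1 : G₀ * ρ.symm ↑u = ρ.symm G₀ := by
      have := congrArg ρ.symm hu
      rw [map_mul, RingEquiv.symm_apply_apply] at this
      exact this
    exact Associated.symm ⟨Units.map (ρ.symm : PowerSeries (PowerSeries 𝒪) →* PowerSeries (PowerSeries 𝒪)) u, by
      rw [Units.coe_map, MonoidHom.coe_coe]; exact h1⟩
  -- image of `(p, T₂)` under `ρ` is `(p, ρT₂)`
  have hmap : Ideal.map (ρ : PowerSeries (PowerSeries 𝒪) →+* PowerSeries (PowerSeries 𝒪))
      (Ideal.span {const 𝒪 (p : 𝒪), T₂ 𝒪}) = Ideal.span {const 𝒪 (p : 𝒪), ρ (T₂ 𝒪)} := by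
    rw [Ideal.map_span, Set.image_pair, RingHom.coe_coe, hρc]
  have hρTu : ¬ IsUnit (ρ (T₂ 𝒪)) := fun h => by
    have : IsUnit (T₂ 𝒪) := by simpa using h.map ρ.symm
    rw [T₂, PowerSeries.isUnit_iff_constantCoeff, PowerSeries.constantCoeff_C, PowerSeries.isUnit_iff_constantCoeff,
      PowerSeries.constantCoeff_X] at this
    exact not_isUnit_zero this
  refine UniqueFactorizationMonoid.induction_on_coprime (P := fun D => D ∣ G₀ → D ∣ F) G₀ ?_ ?_ ?_ ?_ dvd_rfl
  · intro h; exact absurd (zero_dvd_iff.mp h) hG₀0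
  · intro x hx _; exact hx.dvd
  · intro P k hP hPk
    rcases k with _ | k
    · simp
    have hPp : ¬ P ∣ const 𝒪 (p : 𝒪) := fun h =>
      hG₀p ((hP.irreducible.associated_of_dvd hcp.irreducible h).symm.dvd.trans
        ((dvd_pow_self P (Nat.succ_ne_zero k)).trans hPk))
    have hPc : ¬ const 𝒪 (p : 𝒪) ∣ P := fun h =>
      hPp (hcp.irreducible.associated_of_dvd hP.irreducible h).symm.dvd
    by_cases h2 : P ∈ Ideal.span {const 𝒪 (p : 𝒪), T₂ 𝒪}
    · by_cases h1 : P ∈ Ideal.span {const 𝒪 (p : 𝒪), ρ (T₂ 𝒪)}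
      · -- visible on all deep levels (§8 with `S = ρ T₂`)
        obtain ⟨m₀, hm₀⟩ := exists_level_not_shape_of_mem_span_pair 𝒪 p hmax hρTu hρT h2 h1 hPc
        refine pow_dvd_of_visible_levels 𝒪 p hmax hP hPp (k + 1) F (levels_avoiding 𝒪 p hPp fun n => ?_)
        obtain ⟨m, hnm, hmem⟩ := hlevD _ hPk (max n m₀)
        exact ⟨m, le_of_max_le_left hnm, visible_of_not_shape 𝒪 p hmax m (hm₀ m (le_of_max_le_right hnm)), hmem⟩
      · -- `Q = ρ⁻¹ P ∉ (p, T₂)`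
        have hQ : Prime (ρ.symm P) := (MulEquiv.prime_iff ρ.symm).mpr hP
        have hQ2 : ρ.symm P ∉ Ideal.span {const 𝒪 (p : 𝒪), T₂ 𝒪} := by
          intro hmem
          apply h1
          have := Ideal.mem_map_of_mem (ρ : PowerSeries (PowerSeries 𝒪) →+* PowerSeries (PowerSeries 𝒪)) hmem
          rwa [hmap, RingHom.coe_coe, RingEquiv.apply_symm_apply] at this
        have hQp : ¬ ρ.symm P ∣ const 𝒪 (p : 𝒪) := fun h => hPp (by
          have := map_dvd (ρ : PowerSeries (PowerSeries 𝒪) →+* PowerSeries (PowerSeries 𝒪)) h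
          rwa [RingHom.coe_coe, RingEquiv.apply_symm_apply, hρc] at this)
        have hQk : ρ.symm P ^ (k + 1) ∣ G₀ := by
          rw [← map_pow]; exact (map_dvd ρ.symm hPk).trans hρsG₀.dvd
        have hQF : ρ.symm P ^ (k + 1) ∣ F := by
          refine pow_dvd_of_visible_levels 𝒪 p hmax hQ hQp (k + 1) F (levels_avoiding 𝒪 p hQp fun n => ?_)
          obtain ⟨m, hnm, hmem⟩ := hlevD _ hQk n
          exact ⟨m, hnm, visible_of_not_shape 𝒪 p hmax m
            (not_shape_of_not_mem_span_T₂ 𝒪 p m hmax hQ2 hQ.not_unit), hmem⟩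
        have h1' : P ^ (k + 1) ∣ ρ F := by
          have := map_dvd (ρ : PowerSeries (PowerSeries 𝒪) →+* PowerSeries (PowerSeries 𝒪)) hQF
          rwa [RingHom.coe_coe, map_pow, RingEquiv.apply_symm_apply] at this
        exact h1'.trans hF.dvd
    · refine pow_dvd_of_visible_levels 𝒪 p hmax hP hPp (k + 1) F (levels_avoiding 𝒪 p hPp fun n => ?_)
      obtain ⟨m, hnm, hmem⟩ := hlevD _ hPk n
      exact ⟨m, hnm, visible_of_not_shape 𝒪 p hmax m (not_shape_of_not_mem_span_T₂ 𝒪 p m hmax h2 hP.not_unit),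
        hmem⟩
  · intro x y hxy hx hy hdvd
    exact hxy.mul_dvd (hx (dvd_of_mul_right_dvd hdvd)) (hy (dvd_of_mul_left_dvd hdvd))

/-- **RIGIDITY FOR WEAK REFLECTIONS, rational form.** For every DVR `𝒪` with maximal ideal `(p)`: if `ρ` is a ring
automorphism of `𝒪⟦T₂⟧⟦T₁⟧` fixing constants with `ρ T₂ ∉ (p, T₂)`, and `G, F` are `ρ`-symmetric up to units with
`G ∣ p^{t_m} F (mod E_m(T₂))` on comb levels of unbounded order, then `G ∣ p^a F`.
[cite: Washington1997, §7.1–§7.2 and §13.4; Matsumura1987, Thm. 20.3] -/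
theorem dvd_pow_mul_of_weakReflection (hmax : IsLocalRing.maximalIdeal 𝒪 = Ideal.span {(p : 𝒪)})
    (ρ : PowerSeries (PowerSeries 𝒪) ≃+* PowerSeries (PowerSeries 𝒪)) (hρc : ∀ c : 𝒪, ρ (const 𝒪 c) = const 𝒪 c)
    (hρT : ρ (T₂ 𝒪) ∉ Ideal.span {const 𝒪 (p : 𝒪), T₂ 𝒪})
    (G F : PowerSeries (PowerSeries 𝒪)) (hG : Associated (ρ G) G) (hF : Associated (ρ F) F)
    (hcomb : ThinCombDvdRat 𝒪 p G F) : ∃ a : ℕ, G ∣ const 𝒪 ((p : 𝒪) ^ a) * F := by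
  obtain ⟨hp0, hpu, hprime, hpprime⟩ := p_ne_zero_of_maximalIdeal_eq 𝒪 p hmax
  have hcp : Prime (const 𝒪 (p : 𝒪)) :=
    Literature.NumberTheory.EllipticCurves.prime_C_of_prime (Literature.NumberTheory.EllipticCurves.prime_C_of_prime hpprime)
  by_cases hG0 : G = 0
  · subst hG0
    have := eq_zero_of_thinCombDvdRat_zero 𝒪 p hmax hcomb
    exact ⟨0, by rw [this, mul_zero]⟩
  obtain ⟨n, G₀, hG₀p, rfl⟩ := WfDvdMonoid.max_power_factor' hG0 hcp.not_unit
  have hG₀0 : G₀ ≠ 0 := right_ne_zero_of_mul hG0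
  have hρG₀ : Associated (ρ G₀) G₀ := by
    obtain ⟨u, hu⟩ := hG
    rw [map_mul, map_pow, hρc, mul_assoc] at hu
    exact ⟨u, mul_left_cancel₀ (pow_ne_zero n hcp.ne_zero) hu⟩
  have hlev : ∀ k : ℕ, ∃ m : ℕ, k ≤ m ∧
      ∃ t : ℕ, const 𝒪 ((p : 𝒪) ^ t) * F ∈ Ideal.span {G₀, combElt 𝒪 p m} := by
    intro k
    obtain ⟨m, hkm, t, hmem⟩ := hcomb k
    obtain ⟨a, b, hab⟩ := Ideal.mem_span_pair.mp hmem
    exact ⟨m, hkm, t, Ideal.mem_span_pair.mpr ⟨a * const 𝒪 (p : 𝒪) ^ n, b, by rw [← hab]; ring⟩⟩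
  obtain ⟨c, hc⟩ := pfree_dvd_of_levels_weak 𝒪 p hmax hρc hρT hG₀0 hG₀p hρG₀ hF hlev
  exact ⟨n, c, by rw [map_pow, hc]; ring⟩

/-- **RIGIDITY FOR WEAK REFLECTIONS, integral form**: with integral comb divisibility, `G ∣ F`.
[cite: Washington1997, §7.1–§7.2 and §13.4; Matsumura1987, Thm. 20.3] -/
theorem dvd_of_weakReflection (hmax : IsLocalRing.maximalIdeal 𝒪 = Ideal.span {(p : 𝒪)})
    (ρ : PowerSeries (PowerSeries 𝒪) ≃+* PowerSeries (PowerSeries 𝒪)) (hρc : ∀ c : 𝒪, ρ (const 𝒪 c) = const 𝒪 c)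
    (hρT : ρ (T₂ 𝒪) ∉ Ideal.span {const 𝒪 (p : 𝒪), T₂ 𝒪})
    (G F : PowerSeries (PowerSeries 𝒪)) (hG : Associated (ρ G) G) (hF : Associated (ρ F) F)
    (hcombI : ThinCombDvdInt 𝒪 p G F) : G ∣ F := by
  classical
  obtain ⟨hp0, hpu, hprime, hpprime⟩ := p_ne_zero_of_maximalIdeal_eq 𝒪 p hmax
  haveI := Literature.NumberTheory.IwasawaTheory.uniqueFactorizationMonoid_powerSeries_powerSeries 𝒪
  have hcp : Prime (const 𝒪 (p : 𝒪)) :=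
    Literature.NumberTheory.EllipticCurves.prime_C_of_prime (Literature.NumberTheory.EllipticCurves.prime_C_of_prime hpprime)
  have hcomb : ThinCombDvdRat 𝒪 p G F := fun k => by
    obtain ⟨m, hkm, hmem⟩ := hcombI k
    exact ⟨m, hkm, 0, by rwa [pow_zero, map_one, one_mul]⟩
  by_cases hG0 : G = 0
  · subst hG0
    rw [eq_zero_of_thinCombDvdRat_zero 𝒪 p hmax hcomb]
  obtain ⟨n, G₀, hG₀p, rfl⟩ := WfDvdMonoid.max_power_factor' hG0 hcp.not_unit
  have hG₀0 : G₀ ≠ 0 := right_ne_zero_of_mul hG0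
  have hρG₀ : Associated (ρ G₀) G₀ := by
    obtain ⟨u, hu⟩ := hG
    rw [map_mul, map_pow, hρc, mul_assoc] at hu
    exact ⟨u, mul_left_cancel₀ (pow_ne_zero n hcp.ne_zero) hu⟩
  have hlev : ∀ k : ℕ, ∃ m : ℕ, k ≤ m ∧
      ∃ t : ℕ, const 𝒪 ((p : 𝒪) ^ t) * F ∈ Ideal.span {G₀, combElt 𝒪 p m} := by
    intro k
    obtain ⟨m, hkm, t, hmem⟩ := hcomb k
    obtain ⟨a, b, hab⟩ := Ideal.mem_span_pair.mp hmem
    exact ⟨m, hkm, t, Ideal.mem_span_pair.mpr ⟨a * const 𝒪 (p : 𝒪) ^ n, b, by rw [← hab]; ring⟩⟩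
  have h1 : G₀ ∣ F := pfree_dvd_of_levels_weak 𝒪 p hmax hρc hρT hG₀0 hG₀p hρG₀ hF hlev
  -- the `p`-power part, exactly as in Part IV
  have h2 : const 𝒪 (p : 𝒪) ^ n ∣ F := by
    have hcoef : ∀ i, PowerSeries.C (p : 𝒪) ^ n ∣ PowerSeries.coeff i F := by
      intro i
      by_cases hg : PowerSeries.coeff i F = 0
      · rw [hg]; exact dvd_zero _
      obtain ⟨m₀, hm₀⟩ := C_pow_dvd_of_mk_mem_span 𝒪 p hmax hg
      obtain ⟨m, hm, hmem⟩ := hcombI m₀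
      obtain ⟨a, b, hab⟩ := Ideal.mem_span_pair.mp hmem
      refine hm₀ m hm n ?_
      have hab' : PowerSeries.C (PowerSeries.C (p : 𝒪)) ^ n * (a * G₀) + b * combElt 𝒪 p m = F := by
        rw [← hab]; simp only [const, RingHom.comp_apply]; ring
      have hi := congrArg (PowerSeries.coeff i) hab'
      rw [map_add, combElt, PowerSeries.coeff_mul_C, ← map_pow, ← map_pow, PowerSeries.coeff_C_mul,
        map_pow] at hi
      rw [← hi, map_add, map_mul, map_mul _ (PowerSeries.coeff i b),
        Ideal.Quotient.eq_zero_iff_mem.mpr (Ideal.mem_span_singleton_self (combSeries 𝒪 p m)), mul_zero,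
        add_zero]
      refine Ideal.mul_mem_right _ _ ?_
      have : Ideal.Quotient.mk (Ideal.span {combSeries 𝒪 p m}) (PowerSeries.C (p : 𝒪) ^ n) =
          (p : LevelRing 𝒪 p m) ^ n := by simp
      rw [this]; exact Ideal.mem_span_singleton_self _
    choose q hq using hcoef
    refine ⟨PowerSeries.mk q, ?_⟩
    ext i : 1
    rw [hq i, show const 𝒪 (p : 𝒪) ^ n = PowerSeries.C (PowerSeries.C (p : 𝒪) ^ n) by
      simp only [const, RingHom.comp_apply, map_pow], PowerSeries.coeff_C_mul, PowerSeries.coeff_mk]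
  have hrel : IsRelPrime (const 𝒪 (p : 𝒪) ^ n) G₀ :=
    ((hcp.irreducible.isRelPrime_iff_not_dvd).mpr hG₀p).pow_left
  exact hrel.mul_dvd h2 h1

omit [IsDomain 𝒪] [IsDiscreteValuationRing 𝒪] hp in
/-- An `IsReflection` is a weak reflection: it fixes constants and `ρ T₂ = −T₁·(1+T₁)⁻¹ ∉ (p, T₂)` (reduce modulo
`(p, T₂)` to `k⟦T₁⟧`, `k = 𝒪/p` non-trivial). [cite: Washington1997, §13.4] -/
theorem reflection_T₂_not_mem (hpu : ¬ IsUnit (p : 𝒪))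
    {ρ : PowerSeries (PowerSeries 𝒪) ≃+* PowerSeries (PowerSeries 𝒪)} (hρ : IsReflection 𝒪 ρ) :
    ρ (T₂ 𝒪) ∉ Ideal.span {const 𝒪 (p : 𝒪), T₂ 𝒪} := by
  haveI : Nontrivial (𝒪 ⧸ Ideal.span {(p : 𝒪)}) :=
    Ideal.Quotient.nontrivial_iff.mpr (by rwa [Ne, Ideal.span_singleton_eq_top])
  intro hmem
  set θ : PowerSeries (PowerSeries 𝒪) →+* PowerSeries (𝒪 ⧸ Ideal.span {(p : 𝒪)}) :=
    PowerSeries.map ((Ideal.Quotient.mk (Ideal.span {(p : 𝒪)})).comp PowerSeries.constantCoeff) with hθ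
  have hθp : θ (const 𝒪 (p : 𝒪)) = 0 := by
    rw [hθ, const, RingHom.comp_apply, PowerSeries.map_C, RingHom.comp_apply, PowerSeries.constantCoeff_C,
      Ideal.Quotient.eq_zero_iff_mem.mpr (Ideal.mem_span_singleton_self _), map_zero]
  have hθT : θ (T₂ 𝒪) = 0 := by
    rw [hθ, T₂, PowerSeries.map_C, RingHom.comp_apply, PowerSeries.constantCoeff_X, map_zero, map_zero]
  have hθρ : θ (ρ (T₂ 𝒪)) = 0 := by
    obtain ⟨a, b, hab⟩ := Ideal.mem_span_pair.mp hmem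
    rw [← hab, map_add, map_mul, map_mul, hθp, hθT, mul_zero, mul_zero, add_zero]
  -- apply `θ` to `(1 + T₁)(1 + ρ T₂) = 1`: `1 + X = 1` in `k⟦T₁⟧`
  have := congrArg θ hρ.2.1
  rw [map_mul, map_add, map_add, map_one, hθρ, add_zero, mul_one, hθ, T₁, PowerSeries.map_X] at this
  have h1 := congrArg (PowerSeries.coeff 1) this
  simp at h1


/-! ### Transport: the weak hypotheses are coordinate-free -/

/-- **Weak rigidity in arbitrary coordinates (integral form).** Let `σ` be a constant-fixing automorphism of
`Λ₂(𝒪)` (a change of `ℤ_p`-basis) and `ρ'` a constant-fixing automorphism with `ρ'(σ T₂) ∉ (p, σ T₂)`. If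
`ρ' G' ∼ G'`, `ρ' F' ∼ F'` and `F' ∈ (G', σ(E_m(T₂)))` on levels of unbounded order (the comb along the direction
`σ T₂`), then `G' ∣ F'`. USE: `σ T₂ = (1+T₁)^x (1+T₂)^y − 1` for the primitive vector `(x, y)` of the `𝔭′`-inertia
direction in an anticyclotomic-adapted basis, `ρ' = c∘ι`. [cite: Washington1997, §7.1 and §13.4] -/
theorem dvd_of_weakReflection_transport (hmax : IsLocalRing.maximalIdeal 𝒪 = Ideal.span {(p : 𝒪)})
    (σ ρ' : PowerSeries (PowerSeries 𝒪) ≃+* PowerSeries (PowerSeries 𝒪))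
    (hσc : ∀ c : 𝒪, σ (const 𝒪 c) = const 𝒪 c) (hρ'c : ∀ c : 𝒪, ρ' (const 𝒪 c) = const 𝒪 c)
    (hρ'T : ρ' (σ (T₂ 𝒪)) ∉ Ideal.span {const 𝒪 (p : 𝒪), σ (T₂ 𝒪)})
    {G' F' : PowerSeries (PowerSeries 𝒪)} (hG : Associated (ρ' G') G') (hF : Associated (ρ' F') F')
    (hcomb : ∀ n : ℕ, ∃ m : ℕ, n ≤ m ∧ F' ∈ Ideal.span {G', σ (combElt 𝒪 p m)}) : G' ∣ F' := by
  have hσ' : ∀ c : 𝒪, σ.symm (const 𝒪 c) = const 𝒪 c := fun c => by rw [RingEquiv.symm_apply_eq, hσc]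
  set ρ : PowerSeries (PowerSeries 𝒪) ≃+* PowerSeries (PowerSeries 𝒪) := (σ.trans ρ').trans σ.symm with hρdef
  have hρc : ∀ c : 𝒪, ρ (const 𝒪 c) = const 𝒪 c := fun c => by
    rw [hρdef, RingEquiv.trans_apply, RingEquiv.trans_apply, hσc, hρ'c, hσ']
  have hρT : ρ (T₂ 𝒪) ∉ Ideal.span {const 𝒪 (p : 𝒪), T₂ 𝒪} := by
    intro hmem
    apply hρ'T
    have := Ideal.mem_map_of_mem (σ : PowerSeries (PowerSeries 𝒪) →+* PowerSeries (PowerSeries 𝒪)) hmem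
    rw [Ideal.map_span, Set.image_pair, RingHom.coe_coe, hσc, hρdef, RingEquiv.trans_apply,
      RingEquiv.trans_apply, RingEquiv.apply_symm_apply] at this
    exact this
  have key : σ.symm G' ∣ σ.symm F' := by
    refine dvd_of_weakReflection 𝒪 p hmax ρ hρc hρT (σ.symm G') (σ.symm F') ?_ ?_ ?_
    · obtain ⟨u, hu⟩ := hG
      refine ⟨(Units.map (σ.symm : PowerSeries (PowerSeries 𝒪) →* PowerSeries (PowerSeries 𝒪)) u), ?_⟩
      rw [Units.coe_map, MonoidHom.coe_coe, hρdef, RingEquiv.trans_apply, RingEquiv.trans_apply,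
        RingEquiv.apply_symm_apply, ← map_mul, hu]
    · obtain ⟨u, hu⟩ := hF
      refine ⟨(Units.map (σ.symm : PowerSeries (PowerSeries 𝒪) →* PowerSeries (PowerSeries 𝒪)) u), ?_⟩
      rw [Units.coe_map, MonoidHom.coe_coe, hρdef, RingEquiv.trans_apply, RingEquiv.trans_apply,
        RingEquiv.apply_symm_apply, ← map_mul, hu]
    · intro n
      obtain ⟨m, hnm, hmem⟩ := hcomb n
      obtain ⟨a, b, hab⟩ := Ideal.mem_span_pair.mp hmem
      refine ⟨m, hnm, Ideal.mem_span_pair.mpr ⟨σ.symm a, σ.symm b, ?_⟩⟩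
      rw [← hab, map_add, map_mul, map_mul, RingEquiv.symm_apply_apply]
  have := map_dvd (σ : PowerSeries (PowerSeries 𝒪) →+* PowerSeries (PowerSeries 𝒪)) key
  rwa [RingHom.coe_coe, RingEquiv.apply_symm_apply, RingEquiv.apply_symm_apply] at this

end WeakMain


end Summit.BirchSwinnertonDyer.BirchSwinnertonDyer.Theorems.UniversalToricDescentThinComb

end
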